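import Summits.Ventures.PercRepro.C041BlockMapForest
import Summits.Ventures.PercRepro.C041BlockMapAnchorExit
import Summits.Ventures.PercRepro.C041BlockMapTriangleHosts

/-!
# ROW C-041 — THEOREM (BLOCK TREES): a host grown from its anchor by hanging cone blocks is a cone host for every
family of exits (p6, gen 37; the inductive half of §28 (a) of proofs/P6-TWOEXIT-LEAN.md)

A BLOCK `B` with anchor `a₂` that is a cone host for every family of exits (`ConeHostAll B a₂`,
`C041BlockMapForest`) may be HUNG at any vertex `x` of a host `Z` (`hangAt Z B x a₂`: the wedge of `C041BlockMapWedgeHost`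
without its stray vertex — the vertices of `B` other than `a₂` are added, `a₂` is identified with `x`).  THEOREM
(`coneHostAll_hangAt`): if `Z` is a cone host for every family of exits at `a₁` and `B` is one at `a₂`, then `hangAt Z B x
a₂` is one at `inl a₁` — exits anywhere, in `Z`, in `B`, at the cut vertex, with any multiplicities.  PROOF: split the
family into the exits in `Z` and those in `B`; THEOREM (HANG) in its closure form (`Built.hang`) on `Z` with the cut
vertex `x` as an extra exit and on `B`; the stray vertex of the wedge is removed along the zone embedding `embHangAt`
(`coneHost_of_emb`); re-index (`Equiv.sumCompl`).  THE BLOCK-GROWN HOSTS `BlockGrown Z a`: the point, hanging a cone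
block at any vertex, an isolated vertex, an isomorphic host.  **THEOREM (BLOCK TREES)** (`coneHost_of_blockGrown`):
every block-grown host is a cone host for every family of exits — CONJECTURE (BLOCK MAP) passes from the blocks
(each a cone host at its cut vertex towards the anchor, for every family of exits) to the host.  Also here: several
exits at the anchor multiply the block map (`coneHost_sum_anchor`, a family of anchor exits — THEOREM (ANCHOR EXIT)
iterated), the edge host and the edgeless pair are cone hosts for every family (`coneHostAll_edgeHost`,
`coneHostAll_pairHost`: the blocks of a forest), so the forest theorem is the case of `K₂`-blocks.
-/

namespace PercRepro

namespace ZoneZ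

namespace MultiExit

open ZoneData Pendant Finset TwoExit TreeClosure

/-! ## A family of exits at the anchor -/

/-- `ι ⊕ Option κ ≃ Option (ι ⊕ κ)`: the slot `none` of the right summand becomes the slot `none`. -/
def sumOptionEquiv (ι κ : Type) : ι ⊕ Option κ ≃ Option (ι ⊕ κ) where
  toFun := Sum.elim (fun i => some (Sum.inl i)) fun o => o.elim none fun k => some (Sum.inr k)
  invFun := fun o => o.elim (Sum.inr none) (Sum.elim Sum.inl fun k => Sum.inr (some k))
  left_inv := by rintro (i | _ | k) <;> rfl
  right_inv := by rintro (_ | i | k) <;> rfl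

section Anchor

variable {V₁ E₁ U₁ U₂ : Type} (Z₁ : ZoneData V₁ E₁ U₁ U₂) (a₁ : V₁) [Fintype E₁] [DecidableEq E₁]

/-- THEOREM (ANCHOR EXIT) for a family of `n` exits at the anchor, by induction on `n`. -/
theorem coneHost_sum_anchor_card : ∀ (n : ℕ) (κ : Type) [Fintype κ] [DecidableEq κ], Fintype.card κ = n →
    ∀ {ι : Type} [Fintype ι] [DecidableEq ι] (u : ι → V₁), ConeHost Z₁ u a₁ →
      ConeHost Z₁ (Sum.elim u fun _ : κ => a₁) a₁
  | 0, κ, _, _, hκ, ι, _, _, u, h => by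
    haveI : IsEmpty κ := Fintype.card_eq_zero_iff.1 hκ
    have h1 := coneHost_reindex (Equiv.sumEmpty ι κ) h
    convert h1 using 1
    funext x
    rcases x with i | k
    · rfl
    · exact IsEmpty.elim ‹IsEmpty κ› k
  | n + 1, κ, _, _, hκ, ι, _, _, u, h => by
    obtain ⟨k₀⟩ : Nonempty κ := Fintype.card_pos_iff.1 (by omega)
    have hc : Fintype.card {k // k ≠ k₀} = n := by
      have := Fintype.card_congr (Equiv.optionSubtypeNe k₀).symm
      rw [Fintype.card_option] at this
      omega
    have ih := coneHost_sum_anchor_card n {k // k ≠ k₀} hc u h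
    have h2 := coneHost_uplus_anchor Z₁ _ a₁ ih
    let e : ι ⊕ κ ≃ Option (ι ⊕ {k // k ≠ k₀}) :=
      (Equiv.sumCongr (Equiv.refl ι) (Equiv.optionSubtypeNe k₀).symm).trans (sumOptionEquiv ι _)
    have h3 := coneHost_reindex e h2
    convert h3 using 1
    funext x
    rcases x with i | k
    · rfl
    · show a₁ = uplus (Sum.elim u fun _ => a₁) a₁ (sumOptionEquiv ι _ (Sum.inr ((Equiv.optionSubtypeNe k₀).symm k)))
      rcases (Equiv.optionSubtypeNe k₀).symm k with _ | j <;> rfl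

/-- **A family of exits at the anchor** keeps a cone host a cone host. -/
theorem coneHost_sum_anchor {ι κ : Type} [Fintype ι] [DecidableEq ι] [Fintype κ] [DecidableEq κ] (u : ι → V₁)
    (h : ConeHost Z₁ u a₁) : ConeHost Z₁ (Sum.elim u fun _ : κ => a₁) a₁ :=
  coneHost_sum_anchor_card Z₁ a₁ _ κ rfl u h

/-- Every family of exits whose values lie in `{v, a₁}` is a cone family: the exits at `v` by THEOREM (COINCIDENT
EXITS), those at the anchor by the family form of THEOREM (ANCHOR EXIT). -/
theorem coneHost_of_forall_eq_or_eq {ι : Type} [Fintype ι] [DecidableEq ι] (v : V₁) (u : ι → V₁)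
    (hu : ∀ k, u k = v ∨ u k = a₁) : ConeHost Z₁ u a₁ := by
  classical
  have h1 : ConeHost Z₁ (fun _ : {k // u k = v} => v) a₁ := coneHost_const' Z₁ v a₁
  have h2 := coneHost_sum_anchor Z₁ a₁ (κ := {k // ¬ u k = v}) _ h1
  have h3 := coneHost_reindex (Equiv.sumCompl fun k => u k = v).symm h2
  convert h3 using 1
  funext k
  by_cases hk : u k = v
  · rw [Function.comp_apply, Equiv.sumCompl_symm_apply_of_pos (p := fun k => u k = v) hk, Sum.elim_inl, hk]
  · rw [Function.comp_apply, Equiv.sumCompl_symm_apply_of_neg (p := fun k => u k = v) hk, Sum.elim_inr]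
    exact (hu k).resolve_left hk

end Anchor

/-- THE EDGE HOST is a cone host for every family of exits (at its anchor `false`). -/
theorem coneHostAll_edgeHost : ConeHostAll edgeHost false := by
  intro ι _ _ u
  refine coneHost_of_forall_eq_or_eq edgeHost false true u fun k => ?_
  cases h : u k
  · exact Or.inr rfl
  · exact Or.inl rfl

/-- THE EDGELESS PAIR is a cone host for every family of exits. -/
theorem coneHostAll_pairHost : ConeHostAll pairHost false := by
  intro ι _ _ u
  refine coneHost_of_forall_eq_or_eq pairHost false true u fun k => ?_
  cases h : u k
  · exact Or.inr rfl
  · exact Or.inl rfl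

/-! ## Hanging a host at a vertex, without the stray vertex -/

section Hang

variable {V₁ E₁ U₁ W₁ V₂ E₂ U₂ W₂ : Type} (Z₁ : ZoneData V₁ E₁ U₁ W₁) (Z₂ : ZoneData V₂ E₂ U₂ W₂) (x : V₁) (a₂ : V₂)
  [DecidableEq V₂]

/-- The redirection of the vertices of the hung host: the anchor `a₂` to `inl x`, every other vertex to itself. -/
def redH (y : V₂) : V₁ ⊕ {y : V₂ // y ≠ a₂} := if h : y = a₂ then Sum.inl x else Sum.inr ⟨y, h⟩

/-- The host `Z₂` HUNG at `x`: its anchor identified with `x`, its other vertices added. -/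
def hangAt : ZoneData (V₁ ⊕ {y : V₂ // y ≠ a₂}) (E₁ ⊕ E₂) (U₁ ⊕ U₂) (W₁ ⊕ W₂) where
  fst := Sum.elim (fun e => Sum.inl (Z₁.fst e)) fun e => redH x a₂ (Z₂.fst e)
  snd := Sum.elim (fun e => Sum.inl (Z₁.snd e)) fun e => redH x a₂ (Z₂.snd e)
  at₁ := Sum.elim (fun t => Sum.inl (Z₁.at₁ t)) fun t => redH x a₂ (Z₂.at₁ t)
  at₂ := Sum.elim (fun t => Sum.inl (Z₁.at₂ t)) fun t => redH x a₂ (Z₂.at₂ t)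

/-- The vertex map into the wedge: the stray vertex `inr a₂` is not in the image. -/
def hangAtVertexMap : V₁ ⊕ {y : V₂ // y ≠ a₂} → V₁ ⊕ V₂ := Sum.map id Subtype.val

omit [DecidableEq V₂] in
/-- The vertex map is injective. -/
theorem hangAtVertexMap_injective : Function.Injective (hangAtVertexMap (V₁ := V₁) a₂) :=
  Sum.map_injective.2 ⟨Function.injective_id, Subtype.val_injective⟩

/-- The redirections agree through the vertex map. -/
theorem hangAtVertexMap_redH (y : V₂) : hangAtVertexMap a₂ (redH x a₂ y) = redW x a₂ y := by
  unfold hangAtVertexMap redH redW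
  split_ifs with h
  · rfl
  · rfl

/-- The embedding of the hung host into the wedge. -/
def embHangAt : ZoneEmb (hangAt Z₁ Z₂ x a₂) (wedge Z₁ Z₂ x a₂) where
  v := hangAtVertexMap a₂
  inj := hangAtVertexMap_injective a₂
  e := Equiv.refl _
  t₁ := Equiv.refl _
  t₂ := Equiv.refl _
  fst_map := by
    rintro (e | e)
    · rfl
    · exact (hangAtVertexMap_redH x a₂ (Z₂.fst e)).symm
  snd_map := by
    rintro (e | e)
    · rfl
    · exact (hangAtVertexMap_redH x a₂ (Z₂.snd e)).symm
  at₁_map := by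
    rintro (t | t)
    · rfl
    · exact (hangAtVertexMap_redH x a₂ (Z₂.at₁ t)).symm
  at₂_map := by
    rintro (t | t)
    · rfl
    · exact (hangAtVertexMap_redH x a₂ (Z₂.at₂ t)).symm

variable (a₁ : V₁) [Fintype E₁] [DecidableEq E₁] [Fintype E₂] [DecidableEq E₂]

/-- **THEOREM (HANG, SPLIT FAMILY)**: exits `u₁` in `Z₁` and `u₂` in the hung host (with `a₂` read as `x`). -/
theorem coneHost_hangAt_split {ι₁ ι₂ : Type} [Fintype ι₁] [DecidableEq ι₁] [Fintype ι₂] [DecidableEq ι₂]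
    (u₁ : ι₁ → V₁) (u₂ : ι₂ → V₂) (h₁ : ConeHost Z₁ (uplus u₁ x) a₁) (h₂ : ConeHost Z₂ u₂ a₂) :
    ConeHost (hangAt Z₁ Z₂ x a₂) (Sum.elim (fun k => Sum.inl (u₁ k)) fun k => redH x a₂ (u₂ k)) (Sum.inl a₁) := by
  have hb : ConeHost (wedge Z₁ Z₂ x a₂) (wexits x a₂ u₁ u₂) (Sum.inl a₁) :=
    coneHost_of_built (Built.hang Z₁ Z₂ u₁ u₂ a₁ x a₂ (Built.core _ _ _ h₁) (Built.core _ _ _ h₂))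
  refine coneHost_of_emb (embHangAt Z₁ Z₂ x a₂) _ (Sum.inl a₁) ?_ rfl hb
  rintro (k | k)
  · rfl
  · exact (hangAtVertexMap_redH x a₂ (u₂ k)).symm

/-- The exits of a family in `Z₁`. -/
def leftExits {ι : Type} (u : ι → V₁ ⊕ {y : V₂ // y ≠ a₂}) : {k // (u k).isLeft = true} → V₁ :=
  fun k => (u k.1).getLeft k.2

/-- The exits of a family in the hung host. -/
def rightExits {ι : Type} (u : ι → V₁ ⊕ {y : V₂ // y ≠ a₂}) : {k // ¬ (u k).isLeft = true} → V₂ :=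
  fun k => ((u k.1).getRight (by simpa [Sum.not_isLeft] using k.2)).1

omit [DecidableEq V₂] in
/-- The redirection of a vertex other than the anchor. -/
theorem redH_of_ne [DecidableEq V₂] {y : V₂} (h : y ≠ a₂) : redH x a₂ y = Sum.inr ⟨y, h⟩ := by
  unfold redH
  rw [dif_neg h]

omit [DecidableEq V₂] in
/-- The split family re-indexed along `Equiv.sumCompl` is the family. -/
theorem sum_elim_exits_comp [DecidableEq V₂] {ι : Type} (u : ι → V₁ ⊕ {y : V₂ // y ≠ a₂}) :
    (Sum.elim (fun k => Sum.inl (leftExits a₂ u k)) fun k => redH x a₂ (rightExits a₂ u k)) ∘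
      (Equiv.sumCompl fun k => (u k).isLeft = true).symm = u := by
  funext k
  by_cases hk : (u k).isLeft = true
  · rw [Function.comp_apply, Equiv.sumCompl_symm_apply_of_pos (p := fun k => (u k).isLeft = true) hk, Sum.elim_inl]
    exact Sum.inl_getLeft (u k) hk
  · rw [Function.comp_apply, Equiv.sumCompl_symm_apply_of_neg (p := fun k => (u k).isLeft = true) hk, Sum.elim_inr]
    unfold rightExits
    rw [redH_of_ne]
    exact Sum.inr_getRight (u k) _

/-- **THEOREM (HANG, EVERY FAMILY)**: a cone host for every family at `a₁` with a cone host for every family hung at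
`x` is a cone host for every family at `inl a₁`. -/
theorem coneHostAll_hangAt (h₁ : ConeHostAll Z₁ a₁) (h₂ : ConeHostAll Z₂ a₂) :
    ConeHostAll (hangAt Z₁ Z₂ x a₂) (Sum.inl a₁) := by
  intro ι _ _ u
  have hs := coneHost_hangAt_split Z₁ Z₂ x a₂ a₁ (leftExits a₂ u) (rightExits a₂ u) (h₁ _) (h₂ _)
  have hr := coneHost_reindex (Equiv.sumCompl fun k => (u k).isLeft = true).symm hs
  rwa [sum_elim_exits_comp] at hr

end Hang

/-! ## THEOREM (BLOCK TREES) -/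

/-- THE BLOCK-GROWN HOSTS: grown from the point by hanging, at any vertex, a block that is a cone host for every
family of exits at its attachment vertex, by isolated vertices, and up to isomorphism. -/
inductive BlockGrown : ∀ {V E U₁ U₂ : Type} [Fintype E] [DecidableEq E], ZoneData V E U₁ U₂ → V → Prop
  /-- the point -/
  | point : BlockGrown pointHost ()
  /-- a cone block hung at `x` -/
  | hang {V E U₁ W₁ V₂ E₂ U₂ W₂ : Type} [Fintype E] [DecidableEq E] [Fintype E₂] [DecidableEq E₂] [DecidableEq V₂]
      (Z : ZoneData V E U₁ W₁) (a x : V) (B : ZoneData V₂ E₂ U₂ W₂) (a₂ : V₂) (hB : ConeHostAll B a₂)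
      (h : BlockGrown Z a) : BlockGrown (hangAt Z B x a₂) (Sum.inl a)
  /-- an isolated vertex -/
  | isolated {V E U₁ U₂ : Type} [Fintype E] [DecidableEq E] (Z : ZoneData V E U₁ U₂) (a : V)
      (h : BlockGrown Z a) : BlockGrown (addIsolated Z) (some a)
  /-- an isomorphic host -/
  | iso {V₁ E₁ U₁ W₁ V₂ E₂ U₂ W₂ : Type} [Fintype E₁] [DecidableEq E₁] [Fintype E₂] [DecidableEq E₂]
      (Z₁ : ZoneData V₁ E₁ U₁ W₁) (Z₂ : ZoneData V₂ E₂ U₂ W₂) (fv : V₁ ≃ V₂) (fe : E₁ ≃ E₂)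
      (hJ : ∀ e x y, Z₂.Joins (fe e) (fv x) (fv y) ↔ Z₁.Joins e x y) (a : V₁) (h : BlockGrown Z₁ a) :
      BlockGrown Z₂ (fv a)

/-- **THEOREM (BLOCK TREES)**, strongest form: every block-grown host is a cone host for every family of exits. -/
theorem coneHostAll_of_blockGrown {V E U₁ U₂ : Type} [Fintype E] [DecidableEq E] {Z : ZoneData V E U₁ U₂} {a : V}
    (h : BlockGrown Z a) : ConeHostAll Z a := by
  induction h with
  | point => exact coneHostAll_point
  | hang Z a x B a₂ hB _ ih => exact coneHostAll_hangAt Z B x a₂ a ih hB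
  | isolated Z a _ ih => exact coneHostAll_addIsolated Z a ih
  | iso Z₁ Z₂ fv fe hJ a _ ih => exact coneHostAll_iso Z₁ a Z₂ fv fe hJ ih

/-- **THEOREM (BLOCK TREES)**: CONJECTURE (BLOCK MAP) passes from the blocks to the host — every block-grown host,
with any family of exits, is a cone host. -/
theorem coneHost_of_blockGrown {ι V E U₁ U₂ : Type} [Fintype E] [DecidableEq E] [Fintype ι] [DecidableEq ι]
    {Z : ZoneData V E U₁ U₂} {a : V} (h : BlockGrown Z a) (u : ι → V) : ConeHost Z u a :=
  coneHostAll_of_blockGrown h u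

/-- A forest is block-grown with `K₂`-blocks: the edge host hung at `x` (a pendant vertex, up to isomorphism). -/
theorem blockGrown_hang_edge {V E U₁ U₂ : Type} [Fintype E] [DecidableEq E] {Z : ZoneData V E U₁ U₂} {a : V}
    (h : BlockGrown Z a) (x : V) : BlockGrown (hangAt Z edgeHost x false) (Sum.inl a) :=
  BlockGrown.hang Z a x edgeHost false coneHostAll_edgeHost h

end MultiExit

end ZoneZ

end PercRepro
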